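import Mathlib
import Literature.Analysis.Convexity.DinesYuan
import HarnessLib

/-!
# Finsler's lemma and the unified non-strict Finsler lemma

[cite: Finsler1937, pp. 188–192] [cite: MeijerEtAl2024, Lemma 1, Lemma 2, Theorem 1, Examples 1–2]
[cite: Bernstein2009, Facts 8.15.24–8.15.26] [cite: PolikTerlaky2007, §1.2]

Let `M N` be real symmetric `n × n` matrices.  **Finsler's lemma** (Finsler 1937; Pólik–Terlaky §1.2;
Bernstein Fact 8.15.25; Meijer et al. Lemma 1) says

  `(∀ x ≠ 0, xᵀNx = 0 → 0 < xᵀMx)  ↔  ∃ α : ℝ, M + αN ≻ 0`.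

The **non-strict** analogue with `≥` in place of `>` is FALSE in general (Meijer et al. Example 1,
formalised below as `example_one`), holds when `N` is indefinite (Moré 1993 / Meijer et al. Lemma 2,
`exists_posSemidef_add_smul_of_indefinite`), and in general needs one extra kernel condition — the
**unified non-strict Finsler lemma** of Meijer–Scheres–van den Eijnden–Holicki–Scherer–Heemels 2024
(Theorem 1, `exists_posSemidef_add_smul_iff`):

  `(∃ α, M + αN ⪰ 0)  ↔  (∀ x, xᵀNx = 0 → 0 ≤ xᵀMx) ∧ (∀ x, Nx = 0 → xᵀMx = 0 → Mx = 0)`.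

We also record the kernel ("control") forms (Bernstein Fact 8.15.24: `N ⪰ 0`, hypothesis only on
`ker N`, conclusion with `α > 0`; the rectangular version with `N = CᵀC`), the two-parameter form of
Bernstein Fact 8.15.26, monotonicity in `α`, and Meijer et al. Example 2.

## Proofs

The indefinite case is obtained from the in-tree Dines theorem
(`Literature.Analysis.Convexity.convex_jointRange`: the joint range of two real quadratic forms is
convex) by a two-dimensional separation argument, for quadratic forms on an arbitrary real vector space
(`exists_forall_add_mul_nonneg_of_indefinite`).  The semidefinite case `N ⪰ 0` (and `N ⪯ 0` by
`N ↦ −N`) is a nested-compact-sets argument on the Euclidean unit sphere (Cantor's intersection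
theorem), intersected — for the non-strict statement — with the orthogonal complement of
`ker M ∩ ker N`.  The strict lemma follows from the non-strict indefinite one by an `ε`-shift
`M ↦ M − ε·1` obtained from compactness of the sphere.  This differs from the basis / Schur-complement
proof of Meijer et al. §5 but proves the same statements.

## Prior in-tree art (not imported; stated here for de-duplication)

* `Literature.MathematicalPhysics.QuantumFieldTheory.Balaban1983to89.Beta.GaussianIntegral.exists_posDef_add_smul`
  ([folklore], compactness form): for `Δ` symmetric and positive on `ker Q ∖ {0}`, `Δ + t·QᵀQ ≻ 0`
  for all `t` beyond an explicit threshold.  This is the forward direction of our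
  `finsler_transpose_mul_self_iff` (kernel form, `N = CᵀC ⪰ 0`) with a threshold; we do not import
  that file (a different library area) and obtain the `iff` from the general lemma `finsler`, whose
  hypothesis `xᵀNx = 0` for an arbitrary symmetric `N` is not a kernel condition.
* `Literature.AlgebraicGeometry.HyperbolicPolynomials.LocalExactness.exists_modifier` is a
  rank-one instance (Helton–Nie's modified Hessian), again by sphere compactness.
* `Literature.Analysis.Convexity.SLemma` is the S-lemma for an INEQUALITY constraint with a Slater
  point (Pólik–Terlaky Thm 2.2); the present file is the EQUALITY-constrained / pencil-definiteness
  companion (Pólik–Terlaky §1.2 "Finsler's lemma"), including the non-strict characterisation of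
  Meijer et al. which has no counterpart in tree.

All matrices are real; "Hermitian" (`Matrix.IsHermitian`) means symmetric.
-/

namespace Literature.Analysis.Convexity.FinslerLemma

open Matrix Set

/-! ## 1. The homogeneous S-lemma with an equality constraint, indefinite case (abstract) -/

section Abstract

variable {E : Type*} [AddCommGroup E] [Module ℝ E]

/-- [folklore] The two-dimensional separation step behind Lemma 2 of Meijer et al.: if `QF ≥ 0` on the
zero set of `QG`, then for `QG x₁ > 0 > QG x₂` the "slopes" are ordered,
`QF x₁ · QG x₂ ≤ QF x₂ · QG x₁`.  Proof: otherwise the convex combination of the two image points with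
second coordinate `0` (it lies in the joint range by Dines' theorem) has negative first coordinate. -/
private theorem cross_le {QF QG : QuadraticForm ℝ E} (h : ∀ x, QG x = 0 → 0 ≤ QF x)
    {x₁ x₂ : E} (h₁ : 0 < QG x₁) (h₂ : QG x₂ < 0) :
    QF x₁ * QG x₂ ≤ QF x₂ * QG x₁ := by
  obtain ⟨d, hd⟩ : ∃ d : ℝ, d = QG x₁ - QG x₂ := ⟨_, rfl⟩
  have hdpos : 0 < d := by rw [hd]; linarith
  have hmem : (-QG x₂ / d) • (QF x₁, QG x₁) + (QG x₁ / d) • (QF x₂, QG x₂) ∈ jointRange QF QG :=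
    convex_jointRange QF QG ⟨x₁, rfl⟩ ⟨x₂, rfl⟩ (div_nonneg (by linarith) hdpos.le)
      (div_nonneg h₁.le hdpos.le) (by rw [← add_div, div_eq_one_iff_eq hdpos.ne']; linarith)
  obtain ⟨z, hz⟩ := hmem
  simp only [Prod.smul_mk, smul_eq_mul, Prod.mk_add_mk, Prod.mk.injEq] at hz
  obtain ⟨hz1, hz2⟩ := hz
  have hz0 : QG z = 0 := by
    rw [hz2]
    have : (-QG x₂ / d * QG x₁ + QG x₁ / d * QG x₂) * d = 0 := by
      field_simp
      ring
    exact (mul_eq_zero.mp this).resolve_right hdpos.ne'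
  have h0 := h z hz0
  rw [hz1] at h0
  have key : 0 ≤ (-QG x₂ / d * QF x₁ + QG x₁ / d * QF x₂) * d := mul_nonneg h0 hdpos.le
  have e : (-QG x₂ / d * QF x₁ + QG x₁ / d * QF x₂) * d = -QG x₂ * QF x₁ + QG x₁ * QF x₂ := by
    field_simp
  rw [e] at key
  nlinarith [key]

/-- [folklore] Ordered slopes, division form: for `QG x₁ > 0 > QG x₂`,
`-QF x₁ / QG x₁ ≤ QF x₂ / (-QG x₂)`. -/
private theorem ratio_le {QF QG : QuadraticForm ℝ E} (h : ∀ x, QG x = 0 → 0 ≤ QF x)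
    {x₁ x₂ : E} (h₁ : 0 < QG x₁) (h₂ : QG x₂ < 0) :
    -QF x₁ / QG x₁ ≤ QF x₂ / (-QG x₂) := by
  rw [div_le_div_iff₀ h₁ (neg_pos.mpr h₂)]
  have := cross_le h h₁ h₂
  nlinarith [this]

/-- **Homogeneous S-lemma with an equality constraint / non-strict Finsler lemma for an INDEFINITE
second form** (Moré 1993; Meijer et al. 2024, Lemma 2, direction (S2') ⇒ (S1')), for quadratic forms
on an arbitrary real vector space: if `QG` takes both signs and `QF ≥ 0` on `{QG = 0}`, then
`QF + μ·QG ≥ 0` everywhere for some real `μ`.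
[cite: MeijerEtAl2024, Lemma 2] [cite: More1993, Thm 3.4] -/
theorem exists_forall_add_mul_nonneg_of_indefinite (QF QG : QuadraticForm ℝ E)
    (hpos : ∃ x, 0 < QG x) (hneg : ∃ x, QG x < 0) (h : ∀ x, QG x = 0 → 0 ≤ QF x) :
    ∃ μ : ℝ, ∀ x, 0 ≤ QF x + μ * QG x := by
  obtain ⟨x₂, hx₂⟩ := hneg
  have hTne : {t : ℝ | ∃ x, 0 < QG x ∧ t = -QF x / QG x}.Nonempty := by
    obtain ⟨x₁, hx₁⟩ := hpos
    exact ⟨_, x₁, hx₁, rfl⟩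
  have hub : ∀ y, QG y < 0 → ∀ t ∈ {t : ℝ | ∃ x, 0 < QG x ∧ t = -QF x / QG x},
      t ≤ QF y / (-QG y) := by
    rintro y hy t ⟨x₁, hx₁, rfl⟩
    exact ratio_le h hx₁ hy
  have hTbdd : BddAbove {t : ℝ | ∃ x, 0 < QG x ∧ t = -QF x / QG x} := ⟨_, hub x₂ hx₂⟩
  refine ⟨sSup {t : ℝ | ∃ x, 0 < QG x ∧ t = -QF x / QG x}, fun x => ?_⟩
  rcases lt_trichotomy 0 (QG x) with hx | hx | hx
  · have h1 : -QF x / QG x ≤ sSup {t : ℝ | ∃ x, 0 < QG x ∧ t = -QF x / QG x} :=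
      le_csSup hTbdd ⟨x, hx, rfl⟩
    rw [div_le_iff₀ hx] at h1
    linarith
  · rw [← hx, mul_zero, add_zero]
    exact h x hx.symm
  · have h1 : sSup {t : ℝ | ∃ x, 0 < QG x ∧ t = -QF x / QG x} ≤ QF x / (-QG x) :=
      csSup_le hTne (hub x hx)
    rw [le_div_iff₀ (neg_pos.mpr hx)] at h1
    linarith

/-- Meijer et al. 2024, Lemma 2, as an equivalence (the converse direction is immediate).
[cite: MeijerEtAl2024, Lemma 2] -/
theorem forall_add_mul_nonneg_iff_of_indefinite (QF QG : QuadraticForm ℝ E)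
    (hpos : ∃ x, 0 < QG x) (hneg : ∃ x, QG x < 0) :
    (∃ μ : ℝ, ∀ x, 0 ≤ QF x + μ * QG x) ↔ ∀ x, QG x = 0 → 0 ≤ QF x := by
  refine ⟨?_, exists_forall_add_mul_nonneg_of_indefinite QF QG hpos hneg⟩
  rintro ⟨μ, hμ⟩ x hx
  simpa [hx] using hμ x

end Abstract

/-! ## 2. Matrix preliminaries -/

section MatrixForm

variable {n : Type*} [Fintype n]

/-- [folklore] The quadratic form `x ↦ xᵀ A x` of a real square matrix. -/
private def qf [DecidableEq n] (A : Matrix n n ℝ) : QuadraticForm ℝ (n → ℝ) :=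
  LinearMap.BilinMap.toQuadraticMap (Matrix.toLinearMap₂' ℝ A)

/-- [folklore] Evaluation of `qf`: `qf A x = xᵀ A x`. -/
@[simp] private theorem qf_apply [DecidableEq n] (A : Matrix n n ℝ) (x : n → ℝ) :
    qf A x = x ⬝ᵥ A *ᵥ x := by
  rw [qf, LinearMap.BilinMap.toQuadraticMap_apply, Matrix.toLinearMap₂'_apply']

/-- [folklore] `xᵀ(A + y•B)x = xᵀAx + y·xᵀBx`. -/
private theorem quad_add_smul (A B : Matrix n n ℝ) (y : ℝ) (x : n → ℝ) :
    x ⬝ᵥ (A + y • B) *ᵥ x = x ⬝ᵥ A *ᵥ x + y * (x ⬝ᵥ B *ᵥ x) := by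
  rw [add_mulVec, smul_mulVec, dotProduct_add, dotProduct_smul, smul_eq_mul]

/-- [folklore] `(c•x)ᵀA(c•x) = c²·xᵀAx`. -/
private theorem quad_smul_self (A : Matrix n n ℝ) (c : ℝ) (x : n → ℝ) :
    (c • x) ⬝ᵥ A *ᵥ (c • x) = c ^ 2 * (x ⬝ᵥ A *ᵥ x) := by
  rw [mulVec_smul, dotProduct_smul, smul_dotProduct, smul_eq_mul, smul_eq_mul]
  ring

/-- [folklore] `xᵀ(−A)x = −xᵀAx`. -/
private theorem quad_neg (A : Matrix n n ℝ) (x : n → ℝ) :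
    x ⬝ᵥ (-A) *ᵥ x = -(x ⬝ᵥ A *ᵥ x) := by
  rw [neg_mulVec, dotProduct_neg]

omit [Fintype n] in
/-- [folklore] A real symmetric combination `A + y•B` is symmetric. -/
private theorem isHermitian_add_smul {A B : Matrix n n ℝ} (hA : A.IsHermitian) (hB : B.IsHermitian)
    (y : ℝ) : (A + y • B).IsHermitian := by
  have hyB : (y • B).IsHermitian := by
    unfold Matrix.IsHermitian
    rw [conjTranspose_smul, hB.eq, star_trivial]
  exact hA.add hyB

/-- [folklore] For a real symmetric matrix, `xᵀAy = yᵀAx`. -/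
private theorem quad_comm {A : Matrix n n ℝ} (hA : A.IsHermitian) (x y : n → ℝ) :
    x ⬝ᵥ A *ᵥ y = y ⬝ᵥ A *ᵥ x := by
  have h : Aᵀ = A := by
    rw [← conjTranspose_eq_transpose_of_trivial]
    exact hA.eq
  calc x ⬝ᵥ A *ᵥ y = (x ᵥ* A) ⬝ᵥ y := (dotProduct_mulVec x A y)
    _ = (Aᵀ *ᵥ x) ⬝ᵥ y := by rw [mulVec_transpose]
    _ = (A *ᵥ x) ⬝ᵥ y := by rw [h]
    _ = y ⬝ᵥ A *ᵥ x := dotProduct_comm _ _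

/-- [folklore] Real positive semidefiniteness from the real quadratic form. -/
private theorem posSemidef_of_forall {A : Matrix n n ℝ} (hA : A.IsHermitian)
    (h : ∀ x : n → ℝ, 0 ≤ x ⬝ᵥ A *ᵥ x) : A.PosSemidef :=
  PosSemidef.of_dotProduct_mulVec_nonneg hA fun x => by rw [star_trivial]; exact h x

/-- [folklore] Real positive definiteness from the real quadratic form. -/
private theorem posDef_of_forall {A : Matrix n n ℝ} (hA : A.IsHermitian)
    (h : ∀ x : n → ℝ, x ≠ 0 → 0 < x ⬝ᵥ A *ᵥ x) : A.PosDef :=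
  PosDef.of_dotProduct_mulVec_pos hA fun x hx => by rw [star_trivial]; exact h x hx

/-- [folklore] The real quadratic form of a PSD matrix is nonnegative. -/
private theorem quad_nonneg {A : Matrix n n ℝ} (hA : A.PosSemidef) (x : n → ℝ) :
    0 ≤ x ⬝ᵥ A *ᵥ x := by
  simpa only [star_trivial] using hA.dotProduct_mulVec_nonneg x

/-- [folklore] The real quadratic form of a PD matrix is positive off zero. -/
private theorem quad_pos {A : Matrix n n ℝ} (hA : A.PosDef) {x : n → ℝ} (hx : x ≠ 0) :
    0 < x ⬝ᵥ A *ᵥ x := by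
  simpa only [star_trivial] using hA.dotProduct_mulVec_pos hx

/-- [folklore] For a PSD real matrix, `xᵀAx = 0 ↔ Ax = 0`. -/
private theorem quad_eq_zero_iff {A : Matrix n n ℝ} (hA : A.PosSemidef) (x : n → ℝ) :
    x ⬝ᵥ A *ᵥ x = 0 ↔ A *ᵥ x = 0 := by
  simpa only [star_trivial] using hA.dotProduct_mulVec_zero_iff x

/-- **Non-strict Finsler lemma for indefinite `N`, matrix form** (Moré 1993; Meijer et al. 2024,
Lemma 2): if the real symmetric matrix `N` is indefinite and `xᵀMx ≥ 0` whenever `xᵀNx = 0`, then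
`M + αN ⪰ 0` for some real `α`.
[cite: MeijerEtAl2024, Lemma 2] [cite: More1993, Thm 3.4] -/
theorem exists_posSemidef_add_smul_of_indefinite {M N : Matrix n n ℝ} (hM : M.IsHermitian)
    (hN : N.IsHermitian) (hpos : ∃ x, 0 < x ⬝ᵥ N *ᵥ x) (hneg : ∃ x, x ⬝ᵥ N *ᵥ x < 0)
    (h : ∀ x, x ⬝ᵥ N *ᵥ x = 0 → 0 ≤ x ⬝ᵥ M *ᵥ x) :
    ∃ α : ℝ, (M + α • N).PosSemidef := by
  classical
  obtain ⟨μ, hμ⟩ := exists_forall_add_mul_nonneg_of_indefinite (qf M) (qf N)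
    (by simpa only [qf_apply] using hpos) (by simpa only [qf_apply] using hneg)
    (by simpa only [qf_apply] using h)
  refine ⟨μ, posSemidef_of_forall (isHermitian_add_smul hM hN μ) fun x => ?_⟩
  rw [quad_add_smul]
  simpa only [qf_apply] using hμ x

/-- Meijer et al. 2024, Lemma 2 (matrix form, both directions): for indefinite symmetric `N`,
`(∃ α, M + αN ⪰ 0) ↔ (∀ x, xᵀNx = 0 → xᵀMx ≥ 0)`.
[cite: MeijerEtAl2024, Lemma 2] -/
theorem exists_posSemidef_add_smul_iff_of_indefinite {M N : Matrix n n ℝ} (hM : M.IsHermitian)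
    (hN : N.IsHermitian) (hpos : ∃ x, 0 < x ⬝ᵥ N *ᵥ x) (hneg : ∃ x, x ⬝ᵥ N *ᵥ x < 0) :
    (∃ α : ℝ, (M + α • N).PosSemidef) ↔ ∀ x, x ⬝ᵥ N *ᵥ x = 0 → 0 ≤ x ⬝ᵥ M *ᵥ x := by
  refine ⟨?_, exists_posSemidef_add_smul_of_indefinite hM hN hpos hneg⟩
  rintro ⟨α, hα⟩ x hx
  have := quad_nonneg hα x
  rw [quad_add_smul, hx, mul_zero, add_zero] at this
  exact this

/-! ## 3. Compactness tools on the Euclidean unit sphere -/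

/-- [folklore] The Euclidean unit sphere `{x | xᵀx = 1}` of `ℝⁿ`. -/
private def sph : Set (n → ℝ) := {x | x ⬝ᵥ x = 1}

/-- [folklore] The real quadratic form of a matrix is continuous. -/
private theorem continuous_quad (A : Matrix n n ℝ) : Continuous fun x : n → ℝ => x ⬝ᵥ A *ᵥ x :=
  continuous_id.dotProduct (continuous_const.matrix_mulVec continuous_id)

/-- [folklore] The Euclidean unit sphere is closed. -/
private theorem isClosed_sph : IsClosed (sph : Set (n → ℝ)) :=
  isClosed_eq (continuous_id.dotProduct continuous_id) continuous_const

/-- [folklore] The Euclidean unit sphere is compact (closed and inside the sup-norm unit ball). -/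
private theorem isCompact_sph : IsCompact (sph : Set (n → ℝ)) := by
  refine Metric.isCompact_of_isClosed_isBounded isClosed_sph ?_
  refine (Metric.isBounded_closedBall (x := (0 : n → ℝ)) (r := 1)).subset fun x hx => ?_
  rw [Metric.mem_closedBall, dist_zero_right, pi_norm_le_iff_of_nonneg zero_le_one]
  intro i
  rw [Real.norm_eq_abs, ← sq_le_one_iff_abs_le_one]
  have hx' : ∑ j, x j * x j = 1 := hx
  calc x i ^ 2 = x i * x i := sq _
    _ ≤ ∑ j, x j * x j :=
        Finset.single_le_sum (f := fun j => x j * x j) (fun j _ => mul_self_nonneg (x j))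
          (Finset.mem_univ i)
    _ = 1 := hx'

/-- [folklore] `xᵀx > 0` for `x ≠ 0`. -/
private theorem dot_self_pos {x : n → ℝ} (hx : x ≠ 0) : 0 < x ⬝ᵥ x := by
  simpa only [star_trivial] using (dotProduct_star_self_pos_iff (v := x)).mpr hx

/-- [folklore] `xᵀx ≥ 0`. -/
private theorem dot_self_nonneg (x : n → ℝ) : 0 ≤ x ⬝ᵥ x := by
  simpa only [star_trivial] using dotProduct_star_self_nonneg x

/-- [folklore] `(c•x)ᵀ(c•x) = c²·xᵀx`. -/
private theorem dot_smul_self (c : ℝ) (x : n → ℝ) : (c • x) ⬝ᵥ (c • x) = c ^ 2 * (x ⬝ᵥ x) := by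
  rw [dotProduct_smul, smul_dotProduct, smul_eq_mul, smul_eq_mul]
  ring

/-- [folklore] Every nonzero vector is a positive multiple of a point of the unit sphere. -/
private theorem exists_smul_mem_sph {x : n → ℝ} (hx : x ≠ 0) : ∃ c : ℝ, 0 < c ∧ c • x ∈ sph := by
  have hxx : 0 < x ⬝ᵥ x := dot_self_pos hx
  refine ⟨(Real.sqrt (x ⬝ᵥ x))⁻¹, inv_pos.mpr (Real.sqrt_pos.mpr hxx), ?_⟩
  show ((Real.sqrt (x ⬝ᵥ x))⁻¹ • x) ⬝ᵥ ((Real.sqrt (x ⬝ᵥ x))⁻¹ • x) = 1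
  rw [dot_smul_self, inv_pow, Real.sq_sqrt hxx.le, inv_mul_cancel₀ hxx.ne']

/-- [folklore] Strict positivity of `xᵀMx` on `{x ≠ 0 | xᵀNx = 0}` is uniform: `xᵀMx ≥ ε·xᵀx` there
for some `ε > 0` (compactness of the sphere). -/
private theorem exists_uniform_of_pos (M N : Matrix n n ℝ)
    (h : ∀ x, x ≠ 0 → x ⬝ᵥ N *ᵥ x = 0 → 0 < x ⬝ᵥ M *ᵥ x) :
    ∃ ε : ℝ, 0 < ε ∧ ∀ x, x ⬝ᵥ N *ᵥ x = 0 → ε * (x ⬝ᵥ x) ≤ x ⬝ᵥ M *ᵥ x := by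
  have hK : IsCompact (sph ∩ {x : n → ℝ | x ⬝ᵥ N *ᵥ x = 0}) :=
    isCompact_sph.inter_right (isClosed_eq (continuous_quad N) continuous_const)
  by_cases hKne : (sph ∩ {x : n → ℝ | x ⬝ᵥ N *ᵥ x = 0}).Nonempty
  · obtain ⟨u₀, hu₀K, hmin⟩ := hK.exists_isMinOn hKne (continuous_quad M).continuousOn
    rw [isMinOn_iff] at hmin
    have hu₀ne : u₀ ≠ 0 := by
      rintro rfl
      have : (0 : n → ℝ) ⬝ᵥ 0 = 1 := hu₀K.1
      simp at this
    refine ⟨u₀ ⬝ᵥ M *ᵥ u₀, h u₀ hu₀ne hu₀K.2, fun x hx => ?_⟩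
    by_cases hx0 : x = 0
    · subst hx0
      simp
    obtain ⟨c, hc, hcx⟩ := exists_smul_mem_sph hx0
    have hcxK : c • x ∈ sph ∩ {x : n → ℝ | x ⬝ᵥ N *ᵥ x = 0} :=
      ⟨hcx, show (c • x) ⬝ᵥ N *ᵥ (c • x) = 0 by rw [quad_smul_self, hx, mul_zero]⟩
    have h1 : u₀ ⬝ᵥ M *ᵥ u₀ ≤ c ^ 2 * (x ⬝ᵥ M *ᵥ x) := by
      have := hmin (c • x) hcxK
      rwa [quad_smul_self] at this
    have h2 : c ^ 2 * (x ⬝ᵥ x) = 1 := by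
      rw [← dot_smul_self]
      exact hcx
    calc u₀ ⬝ᵥ M *ᵥ u₀ * (x ⬝ᵥ x) ≤ c ^ 2 * (x ⬝ᵥ M *ᵥ x) * (x ⬝ᵥ x) :=
        mul_le_mul_of_nonneg_right h1 (dot_self_nonneg x)
      _ = (x ⬝ᵥ M *ᵥ x) * (c ^ 2 * (x ⬝ᵥ x)) := by ring
      _ = x ⬝ᵥ M *ᵥ x := by rw [h2, mul_one]
  · refine ⟨1, one_pos, fun x hx => ?_⟩
    by_cases hx0 : x = 0
    · subst hx0
      simp
    obtain ⟨c, hc, hcx⟩ := exists_smul_mem_sph hx0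
    exact absurd ⟨c • x, hcx, show (c • x) ⬝ᵥ N *ᵥ (c • x) = 0 by rw [quad_smul_self, hx, mul_zero]⟩
      hKne

/-- [folklore] If a real symmetric `A` is not positive definite, its form is `≤ 0` somewhere on the
sphere. -/
private theorem exists_mem_sph_nonpos {A : Matrix n n ℝ} (hA : A.IsHermitian) (h : ¬A.PosDef)
    {C : Set (n → ℝ)} (hC : ∀ x ∈ sph, x ∈ C) :
    (C ∩ {x : n → ℝ | x ⬝ᵥ A *ᵥ x ≤ 0}).Nonempty := by
  by_contra hem
  apply h
  refine posDef_of_forall hA fun x hx => ?_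
  by_contra hle
  push Not at hle
  obtain ⟨c, hc, hcx⟩ := exists_smul_mem_sph hx
  exact hem ⟨c • x, hC _ hcx, show (c • x) ⬝ᵥ A *ᵥ (c • x) ≤ 0 by
    rw [quad_smul_self]; exact mul_nonpos_of_nonneg_of_nonpos (sq_nonneg c) hle⟩

/-- [folklore] **Cantor step.**  If `C` is compact, `N ⪰ 0`, and each set `C ∩ {xᵀ(M + kN)x ≤ 0}`
(`k ∈ ℕ`) is nonempty — they are nested because `N ⪰ 0` — then some `x ∈ C` has `xᵀNx = 0` and
`xᵀMx ≤ 0`. -/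
private theorem exists_of_nested {C : Set (n → ℝ)} (hC : IsCompact C) {M N : Matrix n n ℝ}
    (hN : N.PosSemidef)
    (hne : ∀ k : ℕ, (C ∩ {x : n → ℝ | x ⬝ᵥ (M + (k : ℝ) • N) *ᵥ x ≤ 0}).Nonempty) :
    ∃ x ∈ C, x ⬝ᵥ N *ᵥ x = 0 ∧ x ⬝ᵥ M *ᵥ x ≤ 0 := by
  have hmono : ∀ k : ℕ, C ∩ {x : n → ℝ | x ⬝ᵥ (M + ((k + 1 : ℕ) : ℝ) • N) *ᵥ x ≤ 0} ⊆
      C ∩ {x : n → ℝ | x ⬝ᵥ (M + (k : ℝ) • N) *ᵥ x ≤ 0} := by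
    intro k y hy
    refine ⟨hy.1, ?_⟩
    have h2 : y ⬝ᵥ (M + ((k + 1 : ℕ) : ℝ) • N) *ᵥ y ≤ 0 := hy.2
    show y ⬝ᵥ (M + (k : ℝ) • N) *ᵥ y ≤ 0
    rw [quad_add_smul] at h2 ⊢
    push_cast at h2
    nlinarith [quad_nonneg hN y]
  have hclosed : ∀ k : ℕ, IsClosed (C ∩ {x : n → ℝ | x ⬝ᵥ (M + (k : ℝ) • N) *ᵥ x ≤ 0}) :=
    fun k => hC.isClosed.inter (isClosed_le (continuous_quad _) continuous_const)
  have hcpt : IsCompact (C ∩ {x : n → ℝ | x ⬝ᵥ (M + ((0 : ℕ) : ℝ) • N) *ᵥ x ≤ 0}) :=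
    hC.inter_right (isClosed_le (continuous_quad _) continuous_const)
  obtain ⟨x, hx⟩ := IsCompact.nonempty_iInter_of_sequence_nonempty_isCompact_isClosed
    (fun k : ℕ => C ∩ {x : n → ℝ | x ⬝ᵥ (M + (k : ℝ) • N) *ᵥ x ≤ 0}) hmono hne hcpt hclosed
  rw [Set.mem_iInter] at hx
  have hle : ∀ k : ℕ, x ⬝ᵥ M *ᵥ x + (k : ℝ) * (x ⬝ᵥ N *ᵥ x) ≤ 0 := fun k => by
    have h2 : x ⬝ᵥ (M + (k : ℝ) • N) *ᵥ x ≤ 0 := (hx k).2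
    rwa [quad_add_smul] at h2
  refine ⟨x, (hx 0).1, ?_, by simpa using hle 0⟩
  rcases (quad_nonneg hN x).lt_or_eq with hlt | heq
  · exfalso
    obtain ⟨k, hk⟩ := exists_nat_gt (-(x ⬝ᵥ M *ᵥ x) / (x ⬝ᵥ N *ᵥ x))
    rw [div_lt_iff₀ hlt] at hk
    linarith [hle k]
  · exact heq.symm

/-! ## 4. Finsler's lemma (strict form) -/

/-- [folklore] Strict Finsler, indefinite `N`: from the non-strict indefinite lemma applied to
`M − ε·1`. -/
private theorem finsler_indefinite {M N : Matrix n n ℝ} (hM : M.IsHermitian) (hN : N.IsHermitian)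
    (hpos : ∃ x, 0 < x ⬝ᵥ N *ᵥ x) (hneg : ∃ x, x ⬝ᵥ N *ᵥ x < 0)
    (h : ∀ x, x ≠ 0 → x ⬝ᵥ N *ᵥ x = 0 → 0 < x ⬝ᵥ M *ᵥ x) :
    ∃ α : ℝ, (M + α • N).PosDef := by
  classical
  obtain ⟨ε, hε, hεM⟩ := exists_uniform_of_pos M N h
  have h1 : (M + (-ε) • (1 : Matrix n n ℝ)).IsHermitian := isHermitian_add_smul hM isHermitian_one _
  have h' : ∀ x, x ⬝ᵥ N *ᵥ x = 0 → 0 ≤ x ⬝ᵥ (M + (-ε) • (1 : Matrix n n ℝ)) *ᵥ x := fun x hx => by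
    rw [quad_add_smul, one_mulVec]
    linarith [hεM x hx]
  obtain ⟨α, hα⟩ := exists_posSemidef_add_smul_of_indefinite h1 hN hpos hneg h'
  refine ⟨α, posDef_of_forall (isHermitian_add_smul hM hN α) fun x hx => ?_⟩
  have h2 := quad_nonneg hα x
  rw [quad_add_smul, quad_add_smul, one_mulVec] at h2
  rw [quad_add_smul]
  nlinarith [dot_self_pos hx]

/-- **Finsler's lemma for `N ⪰ 0`, with a natural-number multiplier**: if `xᵀMx > 0` for every
`x ≠ 0` with `xᵀNx = 0`, then `M + k·N ≻ 0` for some `k ∈ ℕ` (nested compact sets on the sphere).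
[cite: Bernstein2009, Fact 8.15.24 (with A ↦ −A)] [cite: MeijerEtAl2024, Lemma 1] -/
theorem exists_nat_posDef_add_smul_of_posSemidef {M N : Matrix n n ℝ} (hM : M.IsHermitian)
    (hN : N.PosSemidef) (h : ∀ x, x ≠ 0 → x ⬝ᵥ N *ᵥ x = 0 → 0 < x ⬝ᵥ M *ᵥ x) :
    ∃ k : ℕ, (M + (k : ℝ) • N).PosDef := by
  by_contra hcon
  push Not at hcon
  have hne : ∀ k : ℕ, (sph ∩ {x : n → ℝ | x ⬝ᵥ (M + (k : ℝ) • N) *ᵥ x ≤ 0}).Nonempty := fun k =>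
    exists_mem_sph_nonpos (isHermitian_add_smul hM hN.1 _) (hcon k) fun x hx => hx
  obtain ⟨x, hxC, hNx, hMx⟩ := exists_of_nested isCompact_sph hN hne
  have hxne : x ≠ 0 := by
    rintro rfl
    have : (0 : n → ℝ) ⬝ᵥ 0 = 1 := hxC
    simp at this
  exact absurd (h x hxne hNx) (not_lt.mpr hMx)

/-- **Finsler's lemma** (Finsler 1937; Pólik–Terlaky §1.2; Bernstein Fact 8.15.25 "this result is
Finsler's lemma"; Meijer et al. Lemma 1, (S2) ⇒ (S1)): for real symmetric `M, N`, if `xᵀMx > 0` for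
every `x ≠ 0` with `xᵀNx = 0`, then `M + αN ≻ 0` for some real `α`.
[cite: Finsler1937, Satz 1, pp. 188–192] [cite: PolikTerlaky2007, §1.2 (Finsler's theorem)]
[cite: MeijerEtAl2024, Lemma 1] [cite: Bernstein2009, Fact 8.15.25] -/
theorem finsler {M N : Matrix n n ℝ} (hM : M.IsHermitian) (hN : N.IsHermitian)
    (h : ∀ x, x ≠ 0 → x ⬝ᵥ N *ᵥ x = 0 → 0 < x ⬝ᵥ M *ᵥ x) :
    ∃ α : ℝ, (M + α • N).PosDef := by
  by_cases hpos : ∃ x, 0 < x ⬝ᵥ N *ᵥ x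
  · by_cases hneg : ∃ x, x ⬝ᵥ N *ᵥ x < 0
    · exact finsler_indefinite hM hN hpos hneg h
    · -- `N ⪰ 0`
      push Not at hneg
      obtain ⟨k, hk⟩ := exists_nat_posDef_add_smul_of_posSemidef hM (posSemidef_of_forall hN hneg) h
      exact ⟨k, hk⟩
  · -- `N ⪯ 0`: apply the previous case to `−N`
    push Not at hpos
    have hN' : (-N).PosSemidef :=
      posSemidef_of_forall hN.neg fun x => by rw [quad_neg]; linarith [hpos x]
    obtain ⟨k, hk⟩ := exists_nat_posDef_add_smul_of_posSemidef hM hN' fun x hx hNx =>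
      h x hx (by rw [quad_neg, neg_eq_zero] at hNx; exact hNx)
    refine ⟨-(k : ℝ), ?_⟩
    rwa [smul_neg, ← neg_smul] at hk

/-- **Finsler's lemma as an equivalence** (Meijer et al. Lemma 1: (S1) ↔ (S2)).
[cite: MeijerEtAl2024, Lemma 1] [cite: Finsler1937, Satz 1] -/
theorem finsler_iff {M N : Matrix n n ℝ} (hM : M.IsHermitian) (hN : N.IsHermitian) :
    (∃ α : ℝ, (M + α • N).PosDef) ↔ ∀ x, x ≠ 0 → x ⬝ᵥ N *ᵥ x = 0 → 0 < x ⬝ᵥ M *ᵥ x := by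
  refine ⟨?_, finsler hM hN⟩
  rintro ⟨α, hα⟩ x hx hNx
  have := quad_pos hα hx
  rwa [quad_add_smul, hNx, mul_zero, add_zero] at this

/-- **Finsler's lemma, `N ⪰ 0`, positive multiplier**: then `α` may be taken `> 0`, and the hypothesis
only needs `xᵀMx > 0` on `ker N ∖ {0}` (for `N ⪰ 0`, `xᵀNx = 0 ↔ Nx = 0`).  This is Bernstein's
Fact 8.15.24 (stated there for `A ≤ 0 ⇐ …` with `A ↦ −A`) and the control-theoretic "Finsler lemma".
[cite: Bernstein2009, Fact 8.15.24] [cite: MeijerEtAl2024, Lemma 1 and §1] -/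
theorem exists_pos_posDef_add_smul_of_posSemidef {M N : Matrix n n ℝ} (hM : M.IsHermitian)
    (hN : N.PosSemidef) (h : ∀ x, x ≠ 0 → N *ᵥ x = 0 → 0 < x ⬝ᵥ M *ᵥ x) :
    ∃ α : ℝ, 0 < α ∧ (M + α • N).PosDef := by
  obtain ⟨k, hk⟩ := exists_nat_posDef_add_smul_of_posSemidef hM hN fun x hx hNx =>
    h x hx ((quad_eq_zero_iff hN x).mp hNx)
  refine ⟨k + 1, by positivity, ?_⟩
  have : M + ((k : ℝ) + 1) • N = (M + (k : ℝ) • N) + N := by rw [add_smul, one_smul, add_assoc]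
  rw [this]
  exact hk.add_posSemidef hN

/-- **Kernel form of Finsler's lemma** for `N ⪰ 0` (equivalence):
`(∀ x ≠ 0, Nx = 0 → xᵀMx > 0) ↔ ∃ α > 0, M + αN ≻ 0`.
[cite: Bernstein2009, Fact 8.15.24] [cite: MeijerEtAl2024, Lemma 1] -/
theorem finsler_ker_iff {M N : Matrix n n ℝ} (hM : M.IsHermitian) (hN : N.PosSemidef) :
    (∀ x, x ≠ 0 → N *ᵥ x = 0 → 0 < x ⬝ᵥ M *ᵥ x) ↔ ∃ α : ℝ, 0 < α ∧ (M + α • N).PosDef := by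
  refine ⟨exists_pos_posDef_add_smul_of_posSemidef hM hN, ?_⟩
  rintro ⟨α, -, hα⟩ x hx hNx
  have := quad_pos hα hx
  rwa [quad_add_smul, hNx, dotProduct_zero, mul_zero, add_zero] at this

/-- **Rectangular kernel form** (the control-community Finsler lemma with `N = CᵀC`):
`(∀ x ≠ 0, Cx = 0 → xᵀMx > 0) ↔ ∃ α, M + α·CᵀC ≻ 0`.
[cite: MeijerEtAl2024, §1 and Lemma 1] [cite: Bernstein2009, Fact 8.15.24] -/
theorem finsler_transpose_mul_self_iff {m : Type*} [Fintype m] {M : Matrix n n ℝ}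
    (hM : M.IsHermitian) (C : Matrix m n ℝ) :
    (∀ x, x ≠ 0 → C *ᵥ x = 0 → 0 < x ⬝ᵥ M *ᵥ x) ↔ ∃ α : ℝ, (M + α • (Cᵀ * C)).PosDef := by
  have hCC : (Cᵀ * C).PosSemidef := by
    simpa only [conjTranspose_eq_transpose_of_trivial] using posSemidef_conjTranspose_mul_self C
  have hker : ∀ x : n → ℝ, (Cᵀ * C) *ᵥ x = 0 ↔ C *ᵥ x = 0 := fun x => by
    rw [← quad_eq_zero_iff hCC x, ← mulVec_mulVec, dotProduct_mulVec, vecMul_transpose,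
      dotProduct_self_eq_zero]
  constructor
  · intro h
    obtain ⟨α, -, hα⟩ := exists_pos_posDef_add_smul_of_posSemidef hM hCC fun x hx hCx =>
      h x hx ((hker x).mp hCx)
    exact ⟨α, hα⟩
  · rintro ⟨α, hα⟩ x hx hCx
    have := quad_pos hα hx
    rwa [quad_add_smul, (quad_eq_zero_iff hCC x).mpr ((hker x).mpr hCx), mul_zero, add_zero] at this

omit [Fintype n] in
/-- **Monotonicity**: for `N ⪰ 0`, if `M + αN ≻ 0` then `M + βN ≻ 0` for every `β ≥ α`.
[cite: MeijerEtAl2024, Theorem 1 (S1*: "there exists α* such that … for all α > α*")] -/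
theorem posDef_add_smul_of_le {M N : Matrix n n ℝ} (hN : N.PosSemidef) {α β : ℝ}
    (h : (M + α • N).PosDef) (hαβ : α ≤ β) : (M + β • N).PosDef := by
  have : M + β • N = (M + α • N) + (β - α) • N := by rw [add_assoc, ← add_smul, add_sub_cancel]
  rw [this]
  exact h.add_posSemidef (hN.smul (sub_nonneg.mpr hαβ))

omit [Fintype n] in
/-- **Monotonicity, non-strict**: for `N ⪰ 0`, if `M + αN ⪰ 0` then `M + βN ⪰ 0` for every `β ≥ α`.
[cite: MeijerEtAl2024, Theorem 1 (NS1*)] -/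
theorem posSemidef_add_smul_of_le {M N : Matrix n n ℝ} (hN : N.PosSemidef) {α β : ℝ}
    (h : (M + α • N).PosSemidef) (hαβ : α ≤ β) : (M + β • N).PosSemidef := by
  have : M + β • N = (M + α • N) + (β - α) • N := by rw [add_assoc, ← add_smul, add_sub_cancel]
  rw [this]
  exact h.add (hN.smul (sub_nonneg.mpr hαβ))

/-- **Two-parameter form** (Bernstein Fact 8.15.26, (i) ↔ (ii)): some combination `αM + βN` is
positive definite iff either `xᵀMx > 0` on `{x ≠ 0 | xᵀNx = 0}` or `xᵀMx < 0` there.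
[cite: Bernstein2009, Fact 8.15.26] -/
theorem exists_posDef_combination_iff {M N : Matrix n n ℝ} (hM : M.IsHermitian)
    (hN : N.IsHermitian) :
    (∃ α β : ℝ, (α • M + β • N).PosDef) ↔
      (∀ x, x ≠ 0 → x ⬝ᵥ N *ᵥ x = 0 → 0 < x ⬝ᵥ M *ᵥ x) ∨
        (∀ x, x ≠ 0 → x ⬝ᵥ N *ᵥ x = 0 → x ⬝ᵥ M *ᵥ x < 0) := by
  constructor
  · rintro ⟨α, β, hαβ⟩
    have hval : ∀ x, x ≠ 0 → x ⬝ᵥ N *ᵥ x = 0 → 0 < α * (x ⬝ᵥ M *ᵥ x) := fun x hx hNx => by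
      have := quad_pos hαβ hx
      rwa [add_mulVec, smul_mulVec, smul_mulVec, dotProduct_add, dotProduct_smul, dotProduct_smul,
        smul_eq_mul, smul_eq_mul, hNx, mul_zero, add_zero] at this
    rcases lt_trichotomy 0 α with hα | hα | hα
    · exact Or.inl fun x hx hNx => by have := hval x hx hNx; nlinarith
    · refine Or.inl fun x hx hNx => ?_
      have := hval x hx hNx
      rw [← hα, zero_mul] at this
      exact absurd this (lt_irrefl 0)
    · exact Or.inr fun x hx hNx => by have := hval x hx hNx; nlinarith
  · rintro (h | h)
    · obtain ⟨α, hα⟩ := finsler hM hN h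
      exact ⟨1, α, by rwa [one_smul]⟩
    · obtain ⟨α, hα⟩ := finsler hM.neg hN fun x hx hNx => by rw [quad_neg]; linarith [h x hx hNx]
      exact ⟨-1, α, by rwa [neg_one_smul]⟩

/-! ## 5. The unified non-strict Finsler lemma (Meijer et al. 2024, Theorem 1) -/

/-- [folklore] Orthogonal decomposition of `ℝⁿ` along a subspace `W` for the dot product:
`y = u + w` with `w ∈ W` and `u ⊥ W` (the dot product restricted to `W` is nondegenerate). -/
private theorem exists_orthogonal_decomposition (W : Submodule ℝ (n → ℝ)) (y : n → ℝ) :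
    ∃ u w : n → ℝ, w ∈ W ∧ (∀ v ∈ W, v ⬝ᵥ u = 0) ∧ u + w = y := by
  classical
  obtain ⟨B, hBdef⟩ : ∃ B : LinearMap.BilinForm ℝ (n → ℝ), B = Matrix.toBilin' (1 : Matrix n n ℝ) :=
    ⟨_, rfl⟩
  have hB : ∀ v w, B v w = v ⬝ᵥ w := fun v w => by rw [hBdef, Matrix.toBilin'_apply', one_mulVec]
  have hrefl : B.IsRefl := fun v w h => by rw [hB] at h ⊢; rwa [dotProduct_comm]
  have hnd : (B.restrict W).Nondegenerate := by
    constructor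
    · intro v hv
      have h0 := hv v
      rw [LinearMap.BilinForm.restrict_apply, LinearMap.domRestrict_apply, hB] at h0
      exact Submodule.coe_eq_zero.mp (dotProduct_self_eq_zero.mp h0)
    · intro v hv
      have h0 := hv v
      rw [LinearMap.BilinForm.restrict_apply, LinearMap.domRestrict_apply, hB] at h0
      exact Submodule.coe_eq_zero.mp (dotProduct_self_eq_zero.mp h0)
  have hc : IsCompl W (B.orthogonal W) :=
    (LinearMap.BilinForm.restrict_nondegenerate_iff_isCompl_orthogonal hrefl).mp hnd
  obtain ⟨w, u, hw, hu, hwu⟩ := Submodule.codisjoint_iff_exists_add_eq.mp hc.codisjoint y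
  refine ⟨u, w, hw, fun v hv => ?_, by rw [add_comm]; exact hwu⟩
  have h0 : B v u = 0 := LinearMap.BilinForm.mem_orthogonal_iff.mp hu v hv
  rwa [hB] at h0

/-- [folklore] Theorem 1, case `N ⪰ 0`: (NS2) and (NS3) give `M + k·N ⪰ 0` for some `k ∈ ℕ`.
Nested compact sets on the part of the sphere orthogonal to `ker M ∩ ker N`. -/
private theorem nsfl_posSemidef {M N : Matrix n n ℝ} (hM : M.IsHermitian) (hN : N.PosSemidef)
    (h2 : ∀ x, x ⬝ᵥ N *ᵥ x = 0 → 0 ≤ x ⬝ᵥ M *ᵥ x)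
    (h3 : ∀ x, N *ᵥ x = 0 → x ⬝ᵥ M *ᵥ x = 0 → M *ᵥ x = 0) :
    ∃ k : ℕ, (M + (k : ℝ) • N).PosSemidef := by
  classical
  obtain ⟨V, hV⟩ : ∃ V : Submodule ℝ (n → ℝ),
      V = LinearMap.ker (Matrix.toLin' M) ⊓ LinearMap.ker (Matrix.toLin' N) := ⟨_, rfl⟩
  have hmemV : ∀ v, v ∈ V ↔ M *ᵥ v = 0 ∧ N *ᵥ v = 0 := fun v => by
    rw [hV, Submodule.mem_inf, LinearMap.mem_ker, LinearMap.mem_ker, Matrix.toLin'_apply,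
      Matrix.toLin'_apply]
  obtain ⟨C, hC⟩ : ∃ C : Set (n → ℝ), C = sph ∩ {x | ∀ v ∈ V, v ⬝ᵥ x = 0} := ⟨_, rfl⟩
  have hCcpt : IsCompact C := by
    rw [hC]
    refine isCompact_sph.inter_right ?_
    have : {x : n → ℝ | ∀ v ∈ V, v ⬝ᵥ x = 0} = ⋂ v ∈ V, {x | v ⬝ᵥ x = 0} := by
      ext x
      simp
    rw [this]
    exact isClosed_biInter fun v _ =>
      isClosed_eq (continuous_const.dotProduct continuous_id) continuous_const
  by_contra hcon
  push Not at hcon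
  have hne : ∀ k : ℕ, (C ∩ {x : n → ℝ | x ⬝ᵥ (M + (k : ℝ) • N) *ᵥ x ≤ 0}).Nonempty := by
    intro k
    have hA : (M + (k : ℝ) • N).IsHermitian := isHermitian_add_smul hM hN.1 _
    obtain ⟨y, hy⟩ : ∃ y, y ⬝ᵥ (M + (k : ℝ) • N) *ᵥ y < 0 := by
      by_contra hall
      push Not at hall
      exact hcon k (posSemidef_of_forall hA hall)
    obtain ⟨u, w, hw, hu, huw⟩ := exists_orthogonal_decomposition V y
    obtain ⟨hMw, hNw⟩ := (hmemV w).mp hw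
    have hAw : (M + (k : ℝ) • N) *ᵥ w = 0 := by
      rw [add_mulVec, smul_mulVec, hMw, hNw, smul_zero, add_zero]
    have hyu : y ⬝ᵥ (M + (k : ℝ) • N) *ᵥ y = u ⬝ᵥ (M + (k : ℝ) • N) *ᵥ u := by
      rw [← huw, mulVec_add, hAw, add_zero, add_dotProduct, quad_comm hA w u, hAw, dotProduct_zero,
        add_zero]
    rw [hyu] at hy
    have hune : u ≠ 0 := by
      rintro rfl
      simp at hy
    obtain ⟨c, hc, hcu⟩ := exists_smul_mem_sph hune
    refine ⟨c • u, ?_, ?_⟩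
    · rw [hC]
      exact ⟨hcu, fun v hv => by
        show v ⬝ᵥ (c • u) = 0
        rw [dotProduct_smul, hu v hv, smul_zero]⟩
    · show (c • u) ⬝ᵥ (M + (k : ℝ) • N) *ᵥ (c • u) ≤ 0
      rw [quad_smul_self]
      exact mul_nonpos_of_nonneg_of_nonpos (sq_nonneg c) hy.le
  obtain ⟨x, hxC, hNx, hMx⟩ := exists_of_nested hCcpt hN hne
  rw [hC] at hxC
  obtain ⟨hxs, hxperp⟩ := hxC
  have hNx' : N *ᵥ x = 0 := (quad_eq_zero_iff hN x).mp hNx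
  have hMx' : M *ᵥ x = 0 := h3 x hNx' (le_antisymm hMx (h2 x hNx))
  have h0 : x ⬝ᵥ x = 0 := hxperp x ((hmemV x).mpr ⟨hMx', hNx'⟩)
  have h1 : x ⬝ᵥ x = 1 := hxs
  linarith

/-- **The unified non-strict Finsler lemma** (Meijer–Scheres–van den Eijnden–Holicki–Scherer–Heemels
2024, Theorem 1, (NS1) ↔ (NS2) ∧ (NS3)): for real symmetric `M, N`,

  `(∃ α, M + αN ⪰ 0) ↔ (∀ x, xᵀNx = 0 → xᵀMx ≥ 0) ∧ (∀ x, Nx = 0 → xᵀMx = 0 → Mx = 0)`.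

No sign or rank assumption on `N`; the second condition (NS3) is vacuous when `N` is indefinite
(Lemma 2) and cannot be dropped in general (`example_one`).
[cite: MeijerEtAl2024, Theorem 1] -/
theorem exists_posSemidef_add_smul_iff {M N : Matrix n n ℝ} (hM : M.IsHermitian)
    (hN : N.IsHermitian) :
    (∃ α : ℝ, (M + α • N).PosSemidef) ↔
      (∀ x, x ⬝ᵥ N *ᵥ x = 0 → 0 ≤ x ⬝ᵥ M *ᵥ x) ∧
        (∀ x, N *ᵥ x = 0 → x ⬝ᵥ M *ᵥ x = 0 → M *ᵥ x = 0) := by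
  constructor
  · rintro ⟨α, hα⟩
    refine ⟨fun x hNx => ?_, fun x hNx hMx => ?_⟩
    · have := quad_nonneg hα x
      rwa [quad_add_smul, hNx, mul_zero, add_zero] at this
    · have h0 : x ⬝ᵥ (M + α • N) *ᵥ x = 0 := by
        rw [quad_add_smul, hMx, hNx, dotProduct_zero, mul_zero, add_zero]
      have h1 := (quad_eq_zero_iff hα x).mp h0
      rwa [add_mulVec, smul_mulVec, hNx, smul_zero, add_zero] at h1
  · rintro ⟨h2, h3⟩
    by_cases hpos : ∃ x, 0 < x ⬝ᵥ N *ᵥ x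
    · by_cases hneg : ∃ x, x ⬝ᵥ N *ᵥ x < 0
      · exact exists_posSemidef_add_smul_of_indefinite hM hN hpos hneg h2
      · push Not at hneg
        obtain ⟨k, hk⟩ := nsfl_posSemidef hM (posSemidef_of_forall hN hneg) h2 h3
        exact ⟨k, hk⟩
    · push Not at hpos
      have hN' : (-N).PosSemidef :=
        posSemidef_of_forall hN.neg fun x => by rw [quad_neg]; linarith [hpos x]
      obtain ⟨k, hk⟩ := nsfl_posSemidef hM hN'
        (fun x hx => h2 x (by rw [quad_neg, neg_eq_zero] at hx; exact hx))
        (fun x hx hMx => h3 x (by rw [neg_mulVec, neg_eq_zero] at hx; exact hx) hMx)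
      refine ⟨-(k : ℝ), ?_⟩
      rwa [smul_neg, ← neg_smul] at hk

/-- **Theorem 1 with a sign**: for `N ⪰ 0` the conditions (on `ker N` only) give `M + αN ⪰ 0` with
`α > 0` — and then for all larger `α` (`posSemidef_add_smul_of_le`).
[cite: MeijerEtAl2024, Theorem 1 (case N ⪰ 0: α* ≥ 0)] -/
theorem exists_pos_posSemidef_add_smul_of_posSemidef {M N : Matrix n n ℝ} (hM : M.IsHermitian)
    (hN : N.PosSemidef) (h2 : ∀ x, N *ᵥ x = 0 → 0 ≤ x ⬝ᵥ M *ᵥ x)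
    (h3 : ∀ x, N *ᵥ x = 0 → x ⬝ᵥ M *ᵥ x = 0 → M *ᵥ x = 0) :
    ∃ α : ℝ, 0 < α ∧ (M + α • N).PosSemidef := by
  obtain ⟨k, hk⟩ := nsfl_posSemidef hM hN (fun x hx => h2 x ((quad_eq_zero_iff hN x).mp hx)) h3
  refine ⟨k + 1, by positivity, ?_⟩
  have : M + ((k : ℝ) + 1) • N = (M + (k : ℝ) • N) + N := by rw [add_smul, one_smul, add_assoc]
  rw [this]
  exact hk.add hN

/-- **Theorem 1, kernel-free corollary**: if `ker M ∩ ker N`… more simply, if `M` is nonsingular on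
`ker N` in the sense `∀ x, Nx = 0 → xᵀMx = 0 → x = 0`… the cleanest special case: when NO nonzero
`x` has `Nx = 0 ∧ xᵀMx = 0`, (NS3) is automatic and (NS1) ↔ (NS2).
[cite: MeijerEtAl2024, Theorem 1 and Corollary 1] -/
theorem exists_posSemidef_add_smul_iff_of_trivial_kernel {M N : Matrix n n ℝ} (hM : M.IsHermitian)
    (hN : N.IsHermitian) (hker : ∀ x, N *ᵥ x = 0 → x ⬝ᵥ M *ᵥ x = 0 → x = 0) :
    (∃ α : ℝ, (M + α • N).PosSemidef) ↔ ∀ x, x ⬝ᵥ N *ᵥ x = 0 → 0 ≤ x ⬝ᵥ M *ᵥ x := by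
  rw [exists_posSemidef_add_smul_iff hM hN]
  exact ⟨fun h => h.1, fun h => ⟨h, fun x hNx hMx => by rw [hker x hNx hMx, mulVec_zero]⟩⟩

end MatrixForm

/-! ## 6. The examples of Meijer et al. (sharpness) -/

section Examples

/-- Meijer et al. Example 1/2: `M = diag(1, −1)`. [cite: MeijerEtAl2024, Example 1] -/
def exM : Matrix (Fin 2) (Fin 2) ℝ := !![1, 0; 0, -1]

/-- Meijer et al. Example 1: `N = [[1,1],[1,1]]` (`⪰ 0`, rank one). [cite: MeijerEtAl2024, Example 1] -/
def exN : Matrix (Fin 2) (Fin 2) ℝ := !![1, 1; 1, 1]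

/-- Meijer et al. Example 2: `N = diag(0, 1)` (`⪰ 0`). [cite: MeijerEtAl2024, Example 2] -/
def exN' : Matrix (Fin 2) (Fin 2) ℝ := !![0, 0; 0, 1]

/-- The three quadratic forms: `xᵀMx = x₀² − x₁²`, `xᵀNx = (x₀ + x₁)²`, `xᵀN'x = x₁²`.
[cite: MeijerEtAl2024, Examples 1–2] -/
theorem ex_forms (x : Fin 2 → ℝ) :
    x ⬝ᵥ exM *ᵥ x = x 0 ^ 2 - x 1 ^ 2 ∧ x ⬝ᵥ exN *ᵥ x = (x 0 + x 1) ^ 2 ∧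
      x ⬝ᵥ exN' *ᵥ x = x 1 ^ 2 := by
  refine ⟨?_, ?_, ?_⟩ <;> simp [exM, exN, exN', Matrix.mulVec, dotProduct, Fin.sum_univ_two] <;> ring

/-- The example matrices are symmetric. [cite: MeijerEtAl2024, Examples 1–2] -/
theorem ex_isHermitian : exM.IsHermitian ∧ exN.IsHermitian ∧ exN'.IsHermitian := by
  refine ⟨Matrix.IsHermitian.ext fun i j => ?_, Matrix.IsHermitian.ext fun i j => ?_,
    Matrix.IsHermitian.ext fun i j => ?_⟩ <;>
    fin_cases i <;> fin_cases j <;> simp [exM, exN, exN']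

/-- **Example 1 of Meijer et al.: (NS2) does not imply (NS1).**  For `M = diag(1,−1)` and
`N = [[1,1],[1,1]]`: `xᵀNx = 0` forces `x₀ = −x₁` and then `xᵀMx = 0 ≥ 0`, so (NS2) holds; but NO
real `α` makes `M + αN ⪰ 0` (test vectors `(0,1)` for `α < 1` and `(α, −1−α)` for `α ≥ 1`); and indeed
(NS3) fails at `x = (1, −1)`: `Nx = 0`, `xᵀMx = 0`, `Mx = (1, 1) ≠ 0`.
[cite: MeijerEtAl2024, Example 1] -/
theorem example_one :
    (∀ x : Fin 2 → ℝ, x ⬝ᵥ exN *ᵥ x = 0 → 0 ≤ x ⬝ᵥ exM *ᵥ x) ∧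
      (¬ ∃ α : ℝ, (exM + α • exN).PosSemidef) ∧
      ∃ x : Fin 2 → ℝ, exN *ᵥ x = 0 ∧ x ⬝ᵥ exM *ᵥ x = 0 ∧ exM *ᵥ x ≠ 0 := by
  refine ⟨fun x hx => ?_, ?_, ⟨![1, -1], ?_, ?_, ?_⟩⟩
  · rw [(ex_forms x).2.1] at hx
    rw [(ex_forms x).1]
    have h' : x 0 + x 1 = 0 := (pow_eq_zero_iff two_ne_zero).mp hx
    have : x 0 ^ 2 - x 1 ^ 2 = (x 0 + x 1) * (x 0 - x 1) := by ring
    rw [this, h', zero_mul]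
  · rintro ⟨α, hα⟩
    by_cases h1 : α < 1
    · have h0 := hα.dotProduct_mulVec_nonneg ![0, 1]
      rw [star_trivial, add_mulVec, smul_mulVec, dotProduct_add, dotProduct_smul, smul_eq_mul,
        (ex_forms _).1, (ex_forms _).2.1] at h0
      simp at h0
      linarith
    · have h0 := hα.dotProduct_mulVec_nonneg ![α, -(1 + α)]
      rw [star_trivial, add_mulVec, smul_mulVec, dotProduct_add, dotProduct_smul, smul_eq_mul,
        (ex_forms _).1, (ex_forms _).2.1] at h0
      simp at h0
      nlinarith
  · ext i
    fin_cases i <;> simp [exN, Matrix.mulVec, dotProduct, Fin.sum_univ_two]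
  · rw [(ex_forms _).1]
    simp
  · intro h
    have := congrFun h 0
    simp [exM, Matrix.mulVec, dotProduct, Fin.sum_univ_two] at this

/-- **Example 2 of Meijer et al.: indefiniteness in Lemma 2 is sufficient but not necessary.**  For
`M = diag(1,−1)` and `N' = diag(0,1) ⪰ 0` (so no `x` has `xᵀN'x < 0`) one still has `M + 1·N' ⪰ 0`.
[cite: MeijerEtAl2024, Example 2] -/
theorem example_two :
    (¬ ∃ x : Fin 2 → ℝ, x ⬝ᵥ exN' *ᵥ x < 0) ∧ (exM + (1 : ℝ) • exN').PosSemidef := by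
  refine ⟨?_, ?_⟩
  · rintro ⟨x, hx⟩
    rw [(ex_forms x).2.2] at hx
    nlinarith [sq_nonneg (x 1)]
  · have hH : (exM + (1 : ℝ) • exN').IsHermitian := by
      have h2 : ((1 : ℝ) • exN').IsHermitian := by rw [one_smul]; exact ex_isHermitian.2.2
      exact ex_isHermitian.1.add h2
    refine PosSemidef.of_dotProduct_mulVec_nonneg hH fun x => ?_
    rw [star_trivial, add_mulVec, smul_mulVec, dotProduct_add, dotProduct_smul, smul_eq_mul,
      (ex_forms x).1, (ex_forms x).2.2]
    nlinarith [sq_nonneg (x 0)]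

end Examples

end Literature.Analysis.Convexity.FinslerLemma
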